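import Summits.CriticalPhenomena.CardyFormulaZ2.Theorems.CardyBoundaryCoulombGasRectilinearSufficesMixed
import Summits.CriticalPhenomena.CardyFormulaZ2.Theorems.CardyBoundaryCoulombGasRectilinearSufficesSquareModel

/-!
# The lower sandwich: perturbations of the long thin model rectangle cross less than the quad

Support file for `RectilinearSuffices` (route CardyBoundaryCoulombGas of `CardyFormulaZ2`,
item stmt-CriticalPhenomena-5663). Let `Φ` be a square model of the quad `R` and, for
`t, τ > 0`, let `D⁻ = Φ((-1+τ, 1-τ) × (-1-t, 1+t))` be the image of the *narrower and taller*
rectangle (it sticks out of `R` across the arcs `0` (bottom) and `2` (top) and keeps off the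
arcs `1`, `3`). We prove that every conformal rectangle `P` whose boundary loop is uniformly
`ε₁`-close to that of `D⁻`, with the same marks, is in mixed position below the re-modelled quad
`unitSquareQuad.map Φ`, so that for all small meshes its G02 crossing event is contained in that
of the quad (`exists_lower_sandwich`). Here `ε₁ > 0` depends only on `Φ, t, τ` (uniform continuity
of `Φ⁻¹` near the closed rectangle), which is what allows `P` to be a rectilinear polygon later.
-/

noncomputable section

namespace Summit.CriticalPhenomena.CardyFormulaZ2.Theorems

open Set Metric Filter Topology Complex
open Literature.Probability.RandomPlanarGeometry Literature.Probability.Percolation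
open Literature.Probability.LatticeModels

/-- Reading membership in a `Φ`-image in the model. [folklore] -/
theorem mem_image_homeomorph_iff (Φ : ℂ ≃ₜ ℂ) {S : Set ℂ} {z : ℂ} : z ∈ Φ '' S ↔ Φ.symm z ∈ S := by
  rw [← Φ.preimage_symm, mem_preimage]

/-- The frontier of the re-modelled quad off its arc `0` lies in the image of the three lines
`re = 1`, `im = 1`, `re = -1`. [folklore] -/
theorem frontier_map_unitSquareQuad_diff_arc_zero_subset (Φ : ℂ ≃ₜ ℂ) :
    frontier (unitSquareQuad.map Φ).carrier \ (unitSquareQuad.map Φ).arc 0 ⊆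
      Φ '' {p : ℂ | p.re = 1 ∨ p.im = 1 ∨ p.re = -1} := by
  rintro z ⟨hz, hz0⟩
  rw [MarkedDomain.carrier_map, ← Φ.image_frontier] at hz
  rw [MarkedDomain.arc_map] at hz0
  obtain ⟨p, hp, rfl⟩ := hz
  refine ⟨p, ?_, rfl⟩
  have hp0 : p ∉ unitSquareQuad.arc 0 := fun h => hz0 (mem_image_of_mem _ h)
  rw [SquareModel.mem_arc_zero] at hp0
  rw [mem_frontier_unitSquareQuad] at hp
  rcases hp with ⟨hre, him | him⟩ | ⟨hre | hre, -⟩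
  · exact absurd ⟨him, hre⟩ hp0
  · exact Or.inr (Or.inl him)
  · exact Or.inr (Or.inr hre)
  · exact Or.inl hre

/-- The frontier of the re-modelled quad off its arc `2` lies in the image of the three lines
`re = 1`, `im = -1`, `re = -1`. [folklore] -/
theorem frontier_map_unitSquareQuad_diff_arc_two_subset (Φ : ℂ ≃ₜ ℂ) :
    frontier (unitSquareQuad.map Φ).carrier \ (unitSquareQuad.map Φ).arc 2 ⊆
      Φ '' {p : ℂ | p.re = 1 ∨ p.im = -1 ∨ p.re = -1} := by
  rintro z ⟨hz, hz2⟩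
  rw [MarkedDomain.carrier_map, ← Φ.image_frontier] at hz
  rw [MarkedDomain.arc_map] at hz2
  obtain ⟨p, hp, rfl⟩ := hz
  refine ⟨p, ?_, rfl⟩
  have hp2 : p ∉ unitSquareQuad.arc 2 := fun h => hz2 (mem_image_of_mem _ h)
  rw [SquareModel.mem_arc_two] at hp2
  rw [mem_frontier_unitSquareQuad] at hp
  rcases hp with ⟨hre, him | him⟩ | ⟨hre | hre, -⟩
  · exact Or.inr (Or.inl him)
  · exact absurd ⟨him, hre⟩ hp2
  · exact Or.inr (Or.inr hre)
  · exact Or.inl hre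

/-- The two complementary pieces of the frontier of the re-modelled quad are nonempty.
[folklore] -/
theorem frontier_map_unitSquareQuad_diff_arc_nonempty (Φ : ℂ ≃ₜ ℂ) :
    (frontier (unitSquareQuad.map Φ).carrier \ (unitSquareQuad.map Φ).arc 0).Nonempty ∧
      (frontier (unitSquareQuad.map Φ).carrier \ (unitSquareQuad.map Φ).arc 2).Nonempty := by
  rw [MarkedDomain.carrier_map, ← Φ.image_frontier, MarkedDomain.arc_map, MarkedDomain.arc_map]
  constructor
  · refine ⟨Φ ⟨0, 1⟩, mem_image_of_mem _ ?_, fun h => ?_⟩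
    · rw [mem_frontier_unitSquareQuad]; norm_num
    · rw [Φ.injective.mem_set_image, SquareModel.mem_arc_zero] at h; norm_num at h
  · refine ⟨Φ ⟨0, -1⟩, mem_image_of_mem _ ?_, fun h => ?_⟩
    · rw [mem_frontier_unitSquareQuad]; norm_num
    · rw [Φ.injective.mem_set_image, SquareModel.mem_arc_two] at h; norm_num at h

/-- The closure of the re-modelled quad is the image of the closed square. [folklore] -/
theorem closure_map_unitSquareQuad (Φ : ℂ ≃ₜ ℂ) :
    closure (unitSquareQuad.map Φ).carrier = Φ '' (Icc (-1) 1 ×ℂ Icc (-1) 1) := by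
  rw [MarkedDomain.carrier_map, ← Φ.image_closure, unitSquareQuad_carrier,
    Complex.closure_reProdIm, closure_Ioo (by norm_num)]

/-- **The lower sandwich.** See the module docstring. [folklore] -/
theorem exists_lower_sandwich (Φ : ℂ ≃ₜ ℂ) {t τ : ℝ} (ht : 0 < t)
    (hτ : 0 < τ) (hτ1 : τ < 1) :
    ∃ ε₁ > 0, ∀ P : ConformalRectangle, (∀ i, P.mark i = quarterMarks i) →
      (∀ s, dist (P.boundary s)
        ((perturbQuad Φ (-1 + τ) (1 - τ) (-1 - t) (1 + t) (by linarith) (by linarith)).boundary s)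
          ≤ ε₁) →
      ∃ δ₀ > 0, ∀ δ, 0 < δ → δ < δ₀ →
        discreteCrossing P.carrier δ (P.arc 0) (P.arc 2) ⊆
          discreteCrossing (unitSquareQuad.map Φ).carrier δ ((unitSquareQuad.map Φ).arc 0)
            ((unitSquareQuad.map Φ).arc 2) := by
  set D := perturbQuad Φ (-1 + τ) (1 - τ) (-1 - t) (1 + t) (by linarith) (by linarith) with hD
  -- the model tolerance and the uniform continuity of `Φ⁻¹` near the closed rectangle
  set ε₂ : ℝ := min τ t / 4 with hε₂
  have hε₂pos : 0 < ε₂ := by positivity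
  have hε₂τ : 2 * ε₂ < τ := by
    have := min_le_left τ t; rw [hε₂]; linarith
  have hε₂t : ε₂ < t := by
    have := min_le_right τ t; rw [hε₂]; linarith
  set K : Set ℂ := Icc (-1 + τ) (1 - τ) ×ℂ Icc (-1 - t) (1 + t) with hK
  have hKc : IsCompact K := isCompact_Icc.reProdIm isCompact_Icc
  obtain ⟨ε₁, hε₁, -, hΦ⟩ := exists_forall_dist_symm_le Φ hKc hε₂pos
  refine ⟨ε₁, hε₁, fun P hmark hclose => ?_⟩
  have hmarkD : ∀ i, P.mark i = D.mark i := fun i => by rw [hmark, hD, perturbQuad_mark]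
  -- the model sets
  set S0 : Set ℂ := Icc (-1 + τ / 2) (1 - τ / 2) ×ℂ Icc (-1 - 2 * t) (-1) with hS0
  set S2 : Set ℂ := Icc (-1 + τ / 2) (1 - τ / 2) ×ℂ Icc 1 (1 + 2 * t) with hS2
  have hS0c : IsCompact S0 := isCompact_Icc.reProdIm isCompact_Icc
  have hS2c : IsCompact S2 := isCompact_Icc.reProdIm isCompact_Icc
  set T0 : Set ℂ := {p : ℂ | p.re = 1 ∨ p.im = 1 ∨ p.re = -1} with hT0
  set T2 : Set ℂ := {p : ℂ | p.re = 1 ∨ p.im = -1 ∨ p.re = -1} with hT2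
  have hT0c : IsClosed T0 := by
    rw [hT0, Set.setOf_or, Set.setOf_or]
    exact (isClosed_eq continuous_re continuous_const).union
      ((isClosed_eq continuous_im continuous_const).union (isClosed_eq continuous_re continuous_const))
  have hT2c : IsClosed T2 := by
    rw [hT2, Set.setOf_or, Set.setOf_or]
    exact (isClosed_eq continuous_re continuous_const).union
      ((isClosed_eq continuous_im continuous_const).union (isClosed_eq continuous_re continuous_const))
  -- reading a point of `closure P` in the model
  have hfrne : (frontier D.carrier).Nonempty := ⟨_, D.boundary_mem_frontier 0⟩
  have hfrc : IsCompact (frontier D.carrier) := D.isCompact_frontier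
  have hmodel : ∀ z ∈ closure P.carrier,
      (Φ.symm z).re ∈ Icc (-1 + τ / 2) (1 - τ / 2) ∧ (Φ.symm z).im ∈ Icc (-1 - 2 * t) (1 + 2 * t) := by
    intro z hz
    rcases mem_closure_or_infDist_le D.toJordanDomain P.toJordanDomain hclose hz with h | h
    · rw [hD, mem_closure_perturbQuad_carrier] at h
      obtain ⟨⟨h1, h2⟩, h3, h4⟩ := h
      exact ⟨⟨by linarith, by linarith⟩, by linarith, by linarith⟩
    · obtain ⟨q, hq, hqd⟩ := hfrc.exists_infDist_eq_dist hfrne z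
      obtain ⟨q', hq', rfl⟩ := frontier_perturbQuad_subset Φ _ _ hq
      have hd : dist (Φ.symm z) q' ≤ ε₂ := hΦ q' hq' z (hqd ▸ h)
      have hre := abs_le.1 (abs_re_sub_le_of_dist_le hd)
      have him := abs_le.1 (abs_im_sub_le_of_dist_le hd)
      obtain ⟨⟨h1, h2⟩, h3, h4⟩ := mem_reProdIm.1 hq'
      exact ⟨⟨by linarith, by linarith⟩, by linarith, by linarith⟩
  -- reading the arcs `0`, `2` of `P` in the model
  have harc0 : ∀ z ∈ P.arc 0, (Φ.symm z).im < -1 := by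
    intro z hz
    obtain ⟨s, rfl, hs⟩ := exists_param_of_mem_arc hmarkD hz
    rw [hD, mem_perturbQuad_arc_zero] at hs
    have hq' : Φ.symm (D.boundary s) ∈ K := mem_reProdIm.2 ⟨hs.2, by rw [hs.1]; constructor <;> linarith⟩
    have hd : dist (Φ.symm (P.boundary s)) (Φ.symm (D.boundary s)) ≤ ε₂ :=
      hΦ _ hq' _ (by rw [Homeomorph.apply_symm_apply]; exact hclose s)
    have him := abs_le.1 (abs_im_sub_le_of_dist_le hd)
    rw [hs.1] at him
    linarith
  have harc2 : ∀ z ∈ P.arc 2, 1 < (Φ.symm z).im := by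
    intro z hz
    obtain ⟨s, rfl, hs⟩ := exists_param_of_mem_arc hmarkD hz
    rw [hD, mem_perturbQuad_arc_two] at hs
    have hq' : Φ.symm (D.boundary s) ∈ K := mem_reProdIm.2 ⟨hs.2, by rw [hs.1]; constructor <;> linarith⟩
    have hd : dist (Φ.symm (P.boundary s)) (Φ.symm (D.boundary s)) ≤ ε₂ :=
      hΦ _ hq' _ (by rw [Homeomorph.apply_symm_apply]; exact hclose s)
    have him := abs_le.1 (abs_im_sub_le_of_dist_le hd)
    rw [hs.1] at him
    linarith
  obtain ⟨hne0, hne2⟩ := frontier_map_unitSquareQuad_diff_arc_nonempty Φ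
  -- the mixed position
  refine exists_forall_discreteCrossing_subset_of_mixed P (unitSquareQuad.map Φ)
    (F0 := Φ '' S0) (F2 := Φ '' S2) (C0 := Φ '' T0) (C2 := Φ '' T2)
    (hS0c.image Φ.continuous) (hS2c.image Φ.continuous) (Φ.isClosedMap _ hT0c)
    (Φ.isClosedMap _ hT2c) ?_ ?_ ?_ ?_ ?_ ?_ ?_ ?_ hne0 hne2 ?_ ?_ ?_ ?_
  · -- closure P ⊆ quad ∪ F0 ∪ F2
    intro z hz
    obtain ⟨⟨hr1, hr2⟩, hi1, hi2⟩ := hmodel z hz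
    rw [MarkedDomain.carrier_map, unitSquareQuad_carrier, mem_union, mem_union,
      mem_image_homeomorph_iff, mem_image_homeomorph_iff, mem_image_homeomorph_iff, mem_reProdIm,
      hS0, hS2, mem_reProdIm, mem_reProdIm]
    by_cases h1 : (Φ.symm z).im ≤ -1
    · exact Or.inl (Or.inr ⟨⟨hr1, hr2⟩, hi1, h1⟩)
    by_cases h2 : 1 ≤ (Φ.symm z).im
    · exact Or.inr ⟨⟨hr1, hr2⟩, h2, hi2⟩
    push Not at h1 h2
    exact Or.inl (Or.inl ⟨⟨by linarith, by linarith⟩, h1, h2⟩)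
  · -- F0 off the quad
    rw [MarkedDomain.carrier_map, Set.disjoint_image_iff Φ.injective, unitSquareQuad_carrier,
      Set.disjoint_left]
    intro w hw hw'
    rw [hS0, mem_reProdIm] at hw; rw [mem_reProdIm] at hw'
    linarith [hw.2.2, hw'.2.1]
  · rw [MarkedDomain.carrier_map, Set.disjoint_image_iff Φ.injective, unitSquareQuad_carrier,
      Set.disjoint_left]
    intro w hw hw'
    rw [hS2, mem_reProdIm] at hw; rw [mem_reProdIm] at hw'
    linarith [hw.2.1, hw'.2.2]
  · rw [Set.disjoint_image_iff Φ.injective, Set.disjoint_left]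
    intro w hw hw'
    rw [hS0, mem_reProdIm] at hw; rw [hS2, mem_reProdIm] at hw'
    linarith [hw.2.2, hw'.2.1]
  · exact frontier_map_unitSquareQuad_diff_arc_zero_subset Φ
  · exact frontier_map_unitSquareQuad_diff_arc_two_subset Φ
  · rw [Set.disjoint_image_iff Φ.injective, Set.disjoint_left]
    intro w hw hw'
    rw [hS0, mem_reProdIm] at hw
    rcases hw' with h | h | h
    · linarith [hw.1.2]
    · linarith [hw.2.2]
    · linarith [hw.1.1]
  · rw [Set.disjoint_image_iff Φ.injective, Set.disjoint_left]
    intro w hw hw'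
    rw [hS2, mem_reProdIm] at hw
    rcases hw' with h | h | h
    · linarith [hw.1.2]
    · linarith [hw.2.1]
    · linarith [hw.1.1]
  · -- arc 0 of P off the closed quad
    rw [closure_map_unitSquareQuad, Set.disjoint_left]
    intro z hz hz'
    rw [mem_image_homeomorph_iff, mem_reProdIm] at hz'
    linarith [harc0 z hz, hz'.2.1]
  · rw [closure_map_unitSquareQuad, Set.disjoint_left]
    intro z hz hz'
    rw [mem_image_homeomorph_iff, mem_reProdIm] at hz'
    linarith [harc2 z hz, hz'.2.2]
  · rw [Set.disjoint_left]
    intro z hz hz'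
    rw [mem_image_homeomorph_iff, hS2, mem_reProdIm] at hz'
    linarith [harc0 z hz, hz'.2.1]
  · rw [Set.disjoint_left]
    intro z hz hz'
    rw [mem_image_homeomorph_iff, hS0, mem_reProdIm] at hz'
    linarith [harc2 z hz, hz'.2.2]

end Summit.CriticalPhenomena.CardyFormulaZ2.Theorems
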